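import Literature.NumberTheory.EllipticCurves.RationalTorsionOfTamagawaAdditiveProofs
import HarnessLib

/-!
# `p ∣ c_v` at an ADDITIVE place `v ∤ p`: a point of `E[p] ∖ O` fixed by the whole decomposition group;
# at `p = 3` the line `E[3]^{I_v}` carries the TRIVIAL action of `Γ_{K_v}` (theorems only)

`Proofs` file (theorems only: no definition, no named fact, no instance), topic `NumberTheory/EllipticCurves`;
global readings of `RationalTorsionOfTamagawaAdditiveProofs` (a `K_v`-RATIONAL `p`-torsion point off `E₀(K_v)`
when `p ∣ [E(K_v) : E₀(K_v)]` at cuspidal reduction), transported to `E[p] = geomTorsion W p ≤ E(K̄)` along the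
chosen embedding `K̄ → K̄_v` exactly as in `InertiaFixedTorsionOfTamagawaProofs`:

* `WeierstrassCurve.exists_ne_zero_geomTorsion_fixed_of_dvd_localTamagawaNumber_of_hasAdditiveReductionAt` —
  for `E/K` elliptic over a number field, `v` a place of ADDITIVE reduction, `p` a prime with `v ∤ p` and
  `p ∣ c_v` (`localTamagawaNumber`): some `P ∈ E[p]`, `P ≠ O`, is fixed by EVERY `σ ∈ Γ_{K_v}` (acting through
  `absGaloisRestrict K K_v`) — a `K_v`-rational `p`-torsion point (Greenberg, LNM 1716, p. 88:
  "`c_v^{(p)} = |E(F_v)_p|`" at additive `v`; here the existence half).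
* `WeierstrassCurve.exists_line_geomTorsion_three_fixed_of_dvd_localTamagawaNumber` — `p = 3`: there is a
  subgroup `A ≤ E[3]` with `#A = 3`, fixed POINTWISE BY `Γ_{K_v}`, containing every inertia-fixed point of
  `E[3]`.  With `InertiaFixedTorsionAdditiveIndexBoundProofs` / `InertiaFixedTorsionOfTamagawaProofs` ("`E[3]^{I_v}`
  is exactly a line when `3 ∣ c_v`"): **the decomposition group acts on the line `E[3]^{I_v}` through the
  TRIVIAL character.**  Consumer: line `shadow_seed` of crux `KobayashiLowerHalfLargeImage`
  (stmt-BirchSwinnertonDyer-19001), whose local lemma at a Kodaira `IV`/`IV*` prime `q ≠ 3` with `c_q = 3`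
  reads `E[3]|G_{ℚ_q} ≅ (μω ∗; 0 μ)` with `μω = χ_sub`; this file proves `χ_sub = 1` on those rows (so
  `μ = ω|G_{ℚ_q}`, non-trivial iff `q ≡ 2 (mod 3)`, GRANTED the quotient character `= ω·χ_sub⁻¹`, which is the
  Weil-pairing step NOT done here).

Nothing is asserted about any curve; BSD is not proved by any of this.

## References

* [GreenbergLNM1716] R. Greenberg, *Iwasawa theory for elliptic curves*, LNM 1716 (1999), §3 p. 88.
* [SilvermanAEC2009] J. H. Silverman, *The Arithmetic of Elliptic Curves*, 2nd ed. (2009): Thm. VII.6.1 and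
  Cor. VII.6.2 (PDF p. 177), Props. VII.2.1–2.2, VII.3.1.
-/

noncomputable section

open scoped Classical NNReal Pointwise
open NumberField IsDedekindDomain

universe u

namespace WeierstrassCurve

open Literature.NumberTheory.EllipticCurves Literature.NumberTheory.GaloisRepresentations Field
  IsDedekindDomain.HeightOneSpectrum

variable {K : Type u} [Field K] [NumberField K] (W : WeierstrassCurve K) {v : HeightOneSpectrum (𝓞 K)}

/-- Transport of the index of `E₀` along an equality of Weierstrass equations. [folklore] -/
private theorem index_goodReductionSubgroup_eq_of_eq_curve {R : Type*} [CommRing R] [IsDomain R]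
    [IsDiscreteValuationRing R] {L : Type*} [Field L] [Algebra R L] [IsFractionRing R L]
    {Y₁ Y₂ : WeierstrassCurve L} (h : Y₁ = Y₂) [Y₁.IsMinimal R] [Y₂.IsMinimal R] :
    (Y₁.goodReductionSubgroup R).index = (Y₂.goodReductionSubgroup R).index := by
  subst h; rfl

/-- `congrEquiv` along `X₁ = X₂` commutes with the Galois action on `K̄_v`-points. [folklore] -/
private theorem congrEquiv_map_eq_of_eq_curve {F : Type*} [Field F] {L : Type*} [Field L] [Algebra F L]
    {X₁ X₂ : WeierstrassCurve F} (h : X₁ = X₂) (h' : X₁.baseChange L = X₂.baseChange L)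
    (σ : L →ₐ[F] L) (P : (X₁.baseChange L).toAffine.Point) :
    Affine.Point.congrEquiv h' (Affine.Point.map (W' := X₁) σ P) =
      Affine.Point.map (W' := X₂) σ (Affine.Point.congrEquiv h' P) := by
  subst h; rfl

/-- **`p ∣ c_v` at an additive `v ∤ p` ⇒ a `K_v`-rational point of `E[p] ∖ O`.**  For an elliptic curve `E/K`
over a number field, a finite place `v` of ADDITIVE reduction, a prime `p` with `v ∤ p` dividing the local
Tamagawa number `c_v = [E(K_v) : E₀(K_v)]`, there is `P ∈ E[p] = geomTorsion W p`, `P ≠ O`, fixed by EVERY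
element of `Γ_{K_v}` acting through `absGaloisRestrict K K_v` (the `K_v`-rational `p`-torsion point off `E₀`
of `exists_torsion_not_mem_nonsingularReductionSubgroup_of_dvd_index`, read in `E(K̄)` along the chosen
embedding `K̄ → K̄_v`). [cite: GreenbergLNM1716, §3 p. 88]
[cite: SilvermanAEC2009, Thm. VII.6.1 and Cor. VII.6.2 (PDF p. 177)] -/
theorem exists_ne_zero_geomTorsion_fixed_of_dvd_localTamagawaNumber_of_hasAdditiveReductionAt [W.IsElliptic]
    (hadd : W.HasAdditiveReductionAt v) {p : ℕ} (hp : p.Prime) (hpv : (p : 𝓞 K) ∉ v.asIdeal)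
    (hdvd : p ∣ (W.baseChange (v.adicCompletion K)).localTamagawaNumber (v.adicCompletionIntegers K)) :
    ∃ P : geomPoints W, P ≠ 0 ∧ P ∈ geomTorsion W (p : ℤ) ∧
      ∀ σ : absoluteGaloisGroup (v.adicCompletion K), absGaloisRestrict K (v.adicCompletion K) σ • P = P := by
  obtain ⟨w, hw⟩ := v.exists_spectralValuation
  obtain ⟨𝔐, h𝔐⟩ := v.localPrimesAbove_nonempty
  set X := W.localMinimalModel v with hXdef
  haveI : X.IsElliptic := W.isElliptic_localMinimalModel v
  haveI : X.HasAdditiveReduction (v.adicCompletionIntegers K) := hadd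
  haveI : ((W.localMinimalIntegralModel v).baseChange (v.adicCompletion K)).IsElliptic :=
    W.isElliptic_map_localMinimalIntegralModel (v := v)
  haveI : PerfectField (IsLocalRing.ResidueField (v.adicCompletionIntegers K)) := PerfectField.ofFinite
  have hM : W.localMinimalIntegralModel v = X.integralModel (v.adicCompletionIntegers K) := rfl
  have hX₀K : (W.localMinimalIntegralModel v).baseChange (v.adicCompletion K) = X :=
    baseChange_integralModel_eq (v.adicCompletionIntegers K) X
  haveI hminM : ((W.localMinimalIntegralModel v).baseChange (v.adicCompletion K)).IsMinimal
      (v.adicCompletionIntegers K) := by rw [hX₀K]; infer_instance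
  -- cuspidal reduction of the integral minimal model
  have hΔ : (W.localMinimalIntegralModel v).Δ ∈ IsLocalRing.maximalIdeal (v.adicCompletionIntegers K) := by
    have h := HasAdditiveReduction.badReduction (W := X) (R := v.adicCompletionIntegers K)
    rw [← integralModel_Δ_eq (v.adicCompletionIntegers K) X] at h
    exact (valuation_lt_one_iff_mem _ _).mp h
  have hc₄ : (W.localMinimalIntegralModel v).c₄ ∈ IsLocalRing.maximalIdeal (v.adicCompletionIntegers K) := by
    have h := HasAdditiveReduction.additiveReduction (W := X) (R := v.adicCompletionIntegers K)
    rw [← integralModel_c₄_eq (v.adicCompletionIntegers K) X] at h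
    exact (valuation_lt_one_iff_mem _ _).mp h
  -- `c_v` is the index of `E₀(K_v)` on the integral minimal model, and is `≠ 0`
  have hvR := integers_valuationRing_valuation (v.adicCompletionIntegers K) (v.adicCompletion K)
  have hindex : (W.baseChange (v.adicCompletion K)).localTamagawaNumber (v.adicCompletionIntegers K) =
      ((W.localMinimalIntegralModel v).nonsingularReductionSubgroup hvR).index := by
    rw [localTamagawaNumber_baseChange_eq, ← goodReductionSubgroup_baseChange_eq,
      index_goodReductionSubgroup_eq_of_eq_curve hX₀K.symm]
  have h0 : (W.baseChange (v.adicCompletion K)).localTamagawaNumber (v.adicCompletionIntegers K) ≠ 0 := by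
    rw [localTamagawaNumber_baseChange_eq]
    exact index_goodReductionSubgroup_ne_zero_of_finite_residueField (v.adicCompletionIntegers K) X
  rw [hindex] at hdvd h0
  obtain ⟨R, hpR, hRH⟩ :=
    (W.localMinimalIntegralModel v).exists_torsion_not_mem_nonsingularReductionSubgroup_of_dvd_index hw h𝔐
      hΔ hc₄ hp hpv hdvd h0
  have hR0 : R ≠ 0 := fun h ↦ hRH (by rw [h]; exact AddSubgroup.zero_mem _)
  -- `R`, read in `(M ⊗ K_v) ⊗ K̄_v`, is fixed by every `K_v`-algebra endomorphism of `K̄_v`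
  set ι : v.adicCompletion K →ₐ[v.adicCompletion K] AlgebraicClosure (v.adicCompletion K) :=
    Algebra.ofId (v.adicCompletion K) (AlgebraicClosure (v.adicCompletion K)) with hιdef
  set j := Affine.Point.map (W' := ((W.localMinimalIntegralModel v).baseChange (v.adicCompletion K)).toAffine)
    (S := v.adicCompletion K) ι with hjdef
  set R' := j R with hR'def
  have hjinj : Function.Injective j := by rw [hjdef]; exact Affine.Point.map_injective _
  have hR'fix : ∀ σ : AlgebraicClosure (v.adicCompletion K) →ₐ[v.adicCompletion K]
      AlgebraicClosure (v.adicCompletion K), Affine.Point.map σ R' = R' := by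
    intro σ
    rw [hR'def, hjdef, Affine.Point.map_map]
    have hσι : σ.comp ι = ι := AlgHom.ext fun x ↦ by
      rw [AlgHom.comp_apply, hιdef, Algebra.ofId_apply, AlgHom.commutes]
    rw [hσι]
  have hR'0 : R' ≠ 0 := fun h ↦ hR0 (hjinj ((hR'def ▸ h).trans (map_zero j).symm))
  have hpR' : p • R' = 0 := by
    rw [hR'def]
    exact (map_nsmul j p R).symm.trans ((congrArg j hpR).trans (map_zero j))
  -- transport to `X ⊗ K̄_v`, to `E(K̄_v) = localPoints`, to `E(K̄)`
  have hVX : ((W.localMinimalIntegralModel v).baseChange (v.adicCompletion K)).baseChange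
      (AlgebraicClosure (v.adicCompletion K)) = X.baseChange (AlgebraicClosure (v.adicCompletion K)) := by
    rw [hX₀K]
  set R₁ := Affine.Point.congrEquiv hVX R' with hR₁
  obtain ⟨C, hC⟩ := W.exists_variableChange_smul_eq_localMinimalModel v
  obtain ⟨Φ, hΦ⟩ := W.exists_addEquiv_localPoints_of_smul_eq v hC
  set Q₁ : localPoints W (v.adicCompletion K) := Φ.symm R₁ with hQ₁
  have hΦQ₁ : Φ Q₁ = R₁ := by rw [hQ₁, AddEquiv.apply_symm_apply]
  have hpR₁ : p • R₁ = 0 := by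
    rw [hR₁]
    exact ((map_nsmul (Affine.Point.congrEquiv hVX) p R').symm.trans
      (congrArg (Affine.Point.congrEquiv hVX) hpR')).trans (map_zero _)
  have hpQ₁ : p • Q₁ = 0 := Φ.injective (by rw [map_nsmul, hΦQ₁, hpR₁, map_zero])
  have hQ₁fix : ∀ σ : absoluteGaloisGroup (v.adicCompletion K), σ • Q₁ = Q₁ := by
    intro σ
    apply Φ.injective
    rw [hΦ, hΦQ₁, hR₁]
    exact (congrEquiv_map_eq_of_eq_curve hX₀K hVX _ R').symm.trans
      (congrArg (Affine.Point.congrEquiv hVX) (hR'fix _))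
  obtain ⟨P₀, hpP₀, hP₀Q⟩ := exists_pointsMapOfEmb_eq_of_nsmul_eq_zero W
    (closureEmb (K := K) (v.adicCompletion K)) hp.ne_zero hpQ₁
  refine ⟨P₀, fun h0' ↦ hR'0 ?_, (mem_geomTorsion_iff W (p : ℤ) P₀).mpr (by rw [natCast_zsmul, hpP₀]),
    fun σ ↦ ?_⟩
  · have hQ0 : Q₁ = 0 := by rw [← hP₀Q, h0', map_zero]
    have hR₁0 : Affine.Point.congrEquiv hVX R' = 0 := by rw [← hR₁, ← hΦQ₁, hQ0, map_zero]
    exact (AddEquiv.map_eq_zero_iff (Affine.Point.congrEquiv hVX)).mp hR₁0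
  · apply pointsMapOfEmb_injective W (closureEmb (K := K) (v.adicCompletion K))
    have hres : resGalOfEmb (closureEmb (K := K) (v.adicCompletion K)) σ =
        absGaloisRestrict K (v.adicCompletion K) σ := rfl
    rw [← hres, pointsMapOfEmb_smul, hP₀Q, hQ₁fix σ]

/-- **At an additive `v ∤ 3` with `3 ∣ c_v`, the decomposition group `Γ_{K_v}` acts TRIVIALLY on the line
`E[3]^{I_v}`.**  For `E/K` elliptic over a number field, `v` additive, `v ∤ 3`, `3 ∣ c_v`: there is a subgroup
`A ≤ E[3]` with `#A = 3`, fixed pointwise by every `σ ∈ Γ_{K_v}` (through `absGaloisRestrict K K_v`), and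
containing every inertia-fixed point of `E[3]` — the line of
`exists_line_geomTorsion_three_absInertia_fixed_of_dvd_localTamagawaNumber` is generated by the
`K_v`-rational `3`-torsion point of
`exists_ne_zero_geomTorsion_fixed_of_dvd_localTamagawaNumber_of_hasAdditiveReductionAt`.  (Shadow lemma of
line `shadow_seed`, crux `KobayashiLowerHalfLargeImage`: `χ_sub = 1` on the `c_q = 3` rows.)
[cite: GreenbergLNM1716, §3 p. 88] [cite: SilvermanAEC2009, Thm. VII.6.1 (PDF p. 177) and proof of Thm. VII.7.1 (PDF p. 179)] -/
theorem exists_line_geomTorsion_three_fixed_of_dvd_localTamagawaNumber [W.IsElliptic]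
    (hadd : W.HasAdditiveReductionAt v) (h3v : (3 : 𝓞 K) ∉ v.asIdeal)
    (hdvd : 3 ∣ (W.baseChange (v.adicCompletion K)).localTamagawaNumber (v.adicCompletionIntegers K)) :
    ∃ A : AddSubgroup (geomPoints W), A ≤ geomTorsion W (3 : ℤ) ∧ Nat.card A = 3 ∧
      (∀ σ : absoluteGaloisGroup (v.adicCompletion K), ∀ P ∈ A,
        absGaloisRestrict K (v.adicCompletion K) σ • P = P) ∧
      ∀ P ∈ geomTorsion W (3 : ℤ), (∀ σ ∈ absInertia (v.adicCompletion K),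
        absGaloisRestrict K (v.adicCompletion K) σ • P = P) → P ∈ A := by
  obtain ⟨A, hAle, hAcard, -, hAmax⟩ :=
    W.exists_line_geomTorsion_three_absInertia_fixed_of_dvd_localTamagawaNumber hadd h3v hdvd
  obtain ⟨P₀, hP₀0, hP₀3, hP₀fix⟩ :=
    W.exists_ne_zero_geomTorsion_fixed_of_dvd_localTamagawaNumber_of_hasAdditiveReductionAt hadd
      Nat.prime_three (by exact_mod_cast h3v) (by exact_mod_cast hdvd)
  have hP₀A : P₀ ∈ A := hAmax P₀ (by exact_mod_cast hP₀3) (fun σ _ ↦ hP₀fix σ)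
  have hp3P₀ : 3 • P₀ = 0 := by
    have h := (mem_geomTorsion_iff W ((3 : ℕ) : ℤ) P₀).mp hP₀3
    rwa [natCast_zsmul] at h
  have hcardz : Nat.card (AddSubgroup.zmultiples P₀) = 3 := by
    rw [Nat.card_zmultiples, addOrderOf_eq_prime hp3P₀ hP₀0]
  haveI : Finite A := Nat.finite_of_card_ne_zero (by rw [hAcard]; norm_num)
  have hzA : AddSubgroup.zmultiples P₀ = A :=
    AddSubgroup.eq_of_le_of_card_ge (AddSubgroup.zmultiples_le_of_mem hP₀A) (by rw [hAcard, hcardz])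
  refine ⟨A, hAle, hAcard, fun σ P hP ↦ ?_, hAmax⟩
  rw [← hzA, AddSubgroup.mem_zmultiples_iff] at hP
  obtain ⟨k, rfl⟩ := hP
  rw [smul_zsmul_geomPoints, hP₀fix σ]

end WeierstrassCurve

end
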